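import Summits.Langlands.Langlands.Theses.EvenVoidBelowEight
import Literature.NumberTheory.GaloisRepresentations.CalegariEvenFontaineMazurTwo
import Literature.NumberTheory.GaloisRepresentations.AdequateSubgroup

/-!
# Birth skeleton (BC3) — crux `FiveSevenSteinbergShadow` (stmt-Langlands-17644), route `EvenVoidBelowEight`

Route `route-Langlands-EvenVoidBelowEight` (Langlands/Langlands; Calegari's even Fontaine–Mazur theorem
below its printed bound `p > 7`); crux decl
`Summit.Langlands.Langlands.Theses.EvenVoidBelowEight.FiveSevenSteinbergShadow` (rank 4):

  for `p ∈ {5, 7}` there is no continuous EVEN `ρ : Γ_ℚ → GL₂(ℚ̄_p)`, unramified at almost all places,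
  de Rham above `p` (pinned Fontaine datum) with multiplicity-free labelled Hodge–Tate weights, residually
  absolutely irreducible and not of dihedral type.

## The line (`birth`): Calegari's hypothesis (2) as the switch — Sym² shadow / Steinberg shadow / the Klein cell

Calegari II (arXiv:1012.4819) Thm 1.2 kills an even regular `ρ` under hypothesis
(2) "`Sym² ρ̄|_{G_{ℚ(ζ_p)}}` is irreducible" — in the tree's rendering (`Calegari2011_thm_1_2`,
`CalegariEvenFontaineMazurTwo.lean`) `IsAbsIrreducible ((symSq ∘ ρ̄) ∘ (ker ε̄_p).subtype)` — plus `p > 7`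
(used only to make the shadow images adequate) and a local shape hypothesis (c) (removed over `ℚ` by Tung 2021).
The crux drops (2) in favour of "ρ̄ absolutely irreducible, not dihedral".  The skeleton cuts the crux along
(2) and, inside (2), along Thorne-adequacy of the Sym² shadow image `Sym² ρ̄(G_{ℚ(ζ_p)}) ≤ GL₃(𝔽̄_p)`:

* `stub_symSqAdequateShadow` (A1; size L; the re-run of the printed chain): crux hypotheses + (2) +
  `Sym² ρ̄(G_{ℚ(ζ_p)})` adequate (`Subgroup.IsThorneAdequate`, Thorne 2012 Def 2.3) ⟹ `False`.  Calegari II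
  §§3–4 verbatim with the adequacy-based lifting theorems (Thorne 2012 / BLGGT in adequate form, `l ≥ 2(d+1)`
  replaced by the adequacy hypothesis now ASSUMED) and Kisin's component realisation (hypothesis (c)) replaced by
  Tung 2021 (`Tung2021_hilbertTotallySplit`, in tree).
* `stub_steinbergShadow` (A2; size L/XL; the route's NEW content, the "Steinberg shadow"): crux hypotheses +
  (2) + `Sym² ρ̄(G_{ℚ(ζ_p)})` NOT adequate ⟹ `False`.  By Calegari II §6 / Guralnick–Herzig–Tiep 2015 Thm 1.3
  the inadequate-but-irreducible Sym² images at `p ∈ {5,7}` are expected to be exactly those meeting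
  `SL₂(𝔽_p)` (projectively `PSL₂(𝔽₇)`/`PGL₂(𝔽₇)` at `p = 7`, `A₅ ≅ PSL₂(𝔽₅)`/`S₅ ≅ PGL₂(𝔽₅)` with sign
  field `ℚ(√5)` at `p = 5`); there the functorial shadow is `Sym⁴` (`L(4)`, `d = 5 < 7`, adequate) resp. the
  Steinberg module `St₅ = L(4)` (`d = 5 = p`, extended-adequate, GHT-II Cor 9.4), `tr ϱ(c) = +5` against
  Taylor's sign theorem.  Pinning the exact list is the prover's first task (route kill criterion K2).
* `stub_symSqReducible_tetrahedralSeven` (B; size M; PROVABLE NOW, pure group theory): if `ρ̄` is absolutely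
  irreducible and not of dihedral type but (2) FAILS, then `p = 7` and `ρ̄` is of tetrahedral type.  Proof
  sketch (no Dickson needed): `H = ρ̄(ker ε̄_p) ◁ G = ρ̄(Γ_ℚ)` with `G/H` cyclic of order dividing `p − 1`;
  `Sym² ≅ ad⁰ ⊗ det` (char ≠ 2); `ad⁰|_H` reducible ⟺ the projective image `PH` is cyclic or dihedral
  (Clifford: `V|_H` semisimple); a cyclic or `D_m` (`m ≥ 3`) normal `PH` puts `PG` in the normaliser of a
  torus (cyclic or dihedral: excluded); `PH = V₄` puts `PG ≤ N(V₄) ≅ S₄` with `PG/V₄` cyclic, i.e.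
  `PG ∈ {V₄, D₄, A₄}`, so `PG ≅ A₄` and `3 = [PG : PH]` divides `p − 1`: `p = 7`.
* `stub_tetrahedralKleinCell` (C; OPEN — the ceiling cell located by the refuter's crux attack
  `crux-attack-17644.md` + PARI job j022937): `p = 7`, crux hypotheses, `ρ̄` tetrahedral with (2) failing
  (equivalently: the cubic resolvent field of the `A₄`-extension is `ℚ(ζ₇)⁺`, `ρ̄(G_{ℚ(ζ₇)})` projectively
  `V₄`, every `Sym^{2m}` shadow a sum of characters over `ℚ(ζ₇)`) ⟹ `False`.  Expected TRUE (an instance of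
  Fontaine–Mazur; residually the cell is inhabited and automatically even: `x⁴−2x³−14x²+2x+27`, totally real
  `A₄`, resolvent `x³−x²−2x+1` of discriminant `49`), but NO functorial shadow of Calegari type exists there:
  over the totally real cubic field `ℚ(ζ₇)⁺` the restriction `ρ|` is even, regular and residually DIHEDRAL —
  the residually-dihedral even case the route lists under NOT DECOMPOSED YET.  A new lever is needed
  (CM/dihedral congruences over `ℚ(ζ₇)⁺`, or an `ℓ`-adic-image / Khare–Thorne-type detour).

Assembly `FiveSevenSteinbergShadow_of : A1 → A2 → B → C → FiveSevenSteinbergShadow` is a REAL proof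
(classical case split on (2), then on adequacy; in the `¬(2)` branch B supplies `p = 7 ∧ tetrahedral` for C)
and concludes the route decl BY NAME; `FiveSevenSteinbergShadow_of_stubs` instantiates it with the four
`stub_*` (kernel check that the `_Goal` Props are literally the stub types).  `sorry` occurs ONLY in the four
`stub_*` theorems.

Honours the refuter's defect note (item notes, 2026-08-17T05:14Z): "add `IsAbsIrreducible(Sym²ρ̄∘(ker ε̄_p).subtype)`
as in CalegariEvenFontaineMazurTwo and file the V₄-over-ℚ(ζ_p) cell separately" — done at stub level (the crux
itself is fixed).  Disproof used: none exists for this crux (`ledger crux ls stmt-Langlands-17644`: no workfiles,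
no `Disproof.lean`, no `Negative/` lemmas, 2026-08-17).  Negatives index (Langlands, 4 entries: SplitPrimeInduction ×2,
OrdinaryPrimeTransport, K3KugaSatakeDescent) — unrelated.  Dead lines: none on file.

BC3 audit: see `Lines/birth.md` (lean check rc 0, sorries = 4 = stubs, zero elsewhere; probes `stub → crux` and
`stub → Langlands` by `first | exact? | simpa | aesop` FAIL for all four stubs).
-/

-- `Summit.<Summit>.<Problem>`: for the single-conjunct summit `Langlands` the duplicate segment is mandated.
set_option linter.dupNamespace false
set_option linter.unusedVariables false

noncomputable section

namespace Summit.Langlands.Langlands.Cruxes.FiveSevenSteinbergShadow.Birth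

open Summit.Langlands.Langlands.Theses.EvenVoidBelowEight
open Literature.NumberTheory.GaloisRepresentations Literature.NumberTheory.PAdicHodge
open IsDedekindDomain
open scoped NumberField MatrixGroups

/-! ## 1. The four registered stubs

Vocabulary (all tree declarations): `ρ̄ = ρ.residualRep : Γ_ℚ →* GL₂(ℤ̄_p/𝔪)` (`ResidualGaloisRep.lean`);
`ε̄_p = modPCyclotomicCharacterZMod ℚ p : Γ_ℚ →* (ℤ/p)ˣ`, `ker ε̄_p = Γ_{ℚ(ζ_p)}` (`ModPGaloisRep.lean`);
`Sym² = Matrix.GeneralLinearGroup.symSq : GL₂ → GL₃` (`CalegariEvenFontaineMazurTwo.lean`); hypothesis (2) of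
Calegari II Thm 1.2 is `IsAbsIrreducible ((Sym².comp ρ̄).comp (ker ε̄_p).subtype)`; "the Sym² shadow image is
adequate" is `Subgroup.IsThorneAdequate ((Sym².comp ρ̄).comp (ker ε̄_p).subtype).range` (`AdequateSubgroup.lean`,
Thorne 2012 Def 2.3, coefficients `k = ℤ̄_p/𝔪 ⊇ 𝔽̄_p`-eigenvalues); `IsTetrahedralType ρ̄` = projective image
`≃* A₄` (`ProjectiveType.lean`). -/

/-- **Stub A1 — the adequate Sym² shadow (Calegari II Thm 1.2 re-run at `p ∈ {5,7}` over `ℚ`, hypothesis (c)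
dropped).**  For `p ∈ {5, 7}` and `ρ : Γ_ℚ → GL₂(ℚ̄_p)` continuous, even, unramified almost everywhere, de Rham
above `p` with multiplicity-free labelled Hodge–Tate weights, residually absolutely irreducible and non-dihedral,
such that `Sym² ρ̄|_{Γ_{ℚ(ζ_p)}}` is absolutely irreducible AND its image is Thorne-adequate: contradiction.
Why plausibly true: it is Calegari's printed chain (§§3–4: Moret-Bailly residual realisation → component
realisation of `ρ|D_p` by a Hilbert modular shadow → ordinary RACSDC lift of `Sym² ρ̄` over a CM field → second
shadow → potential automorphy of `Sym² ρ_g ⊗ ρ_π` → `tr ϱ(c) = +3` against Taylor's sign theorem) in which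
`p > 7` entered only to guarantee adequacy (now a hypothesis) and (c) only through Kisin (now Tung 2021, `p > 2`);
residual difficulty: adequacy of the 9-dimensional product image and the `l ∤ n`/`l > 2` clauses of the ordinary
inputs at `l ∈ {5,7}`.  Size L.  Leans on: `Calegari2011_thm_1_2` (shape), `Tung2021_hilbertTotallySplit` (tree),
BLGGT Prop 3.3.1 / Thm 4.2.1 / 4.5.1 (arXiv:1010.2561) in Thorne's adequate form (arXiv:1107.5989 Thm 7.1),
Taylor's sign theorem (doi:10.2140/ant.2012.6.405), GHT Thm 1.3 (arXiv:1311.1786) — the last three not yet vendored.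
[cite: Calegari2011, Thm. 1.2 and §6] -/
theorem stub_symSqAdequateShadow :
    ∀ (p : ℕ) [Fact p.Prime], (p = 5 ∨ p = 7) →
      ∀ ρ : FramedGaloisRep ℚ (PadicAlgCl p) 2, ρ.IsEven →
        (∀ᶠ v : HeightOneSpectrum (𝓞 ℚ) in Filter.cofinite, ρ.IsUnramifiedAt v) →
        (∀ (v : HeightOneSpectrum (𝓞 ℚ)) (hv : ((p : ℕ) : 𝓞 ℚ) ∈ v.asIdeal),
          (fontainePstAdicCompletion v p hv).IsDeRhamFramed (ρ.toLocal v) ∧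
            ∀ τ : v.adicCompletion ℚ →+* PadicAlgCl p, Continuous τ →
              (ρ.labelledHodgeTateWeightsAt v (fontainePstAdicCompletion v p hv).algebra
                (fontainePstAdicCompletion v p hv).𝔅 τ).Nodup) →
        ρ.IsResiduallyAbsIrreducible → ¬ IsDihedralType ρ.residualRep →
        IsAbsIrreducible
          ((Matrix.GeneralLinearGroup.symSq.comp ρ.residualRep).comp
            (modPCyclotomicCharacterZMod ℚ p).ker.subtype) →
        Subgroup.IsThorneAdequate
          ((Matrix.GeneralLinearGroup.symSq.comp ρ.residualRep).comp
            (modPCyclotomicCharacterZMod ℚ p).ker.subtype).range →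
        False := by
  sorry

/-- **Stub A2 — the Steinberg / Sym⁴ shadow at the inadequate Sym² images.**  Same hypotheses as A1 with
`Sym² ρ̄|_{Γ_{ℚ(ζ_p)}}` absolutely irreducible but its image NOT Thorne-adequate: contradiction.  By Calegari II
§6 ("`Sym² ρ̄` fails to have adequate image if the image of `ρ̄` is `SL₂(𝔽_p)` and `p ≤ 7`") and
Guralnick–Herzig–Tiep 2015 Thm 1.3 (exceptions `d = (p ± 1)/2` for `H ⊇ SL₂(p)`), the images concerned are
expected to be those meeting `SL₂(𝔽_p)`: projectively `PSL₂(𝔽₇)` (order 168) / `PGL₂(𝔽₇)` at `p = 7`,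
`A₅ ≅ PSL₂(𝔽₅)` (order 60) / `S₅ ≅ PGL₂(𝔽₅)` with sign field `ℚ(√5)` at `p = 5` — pinning this list is the
first task (route kill criterion K2).  Why plausibly true: replace the shadow `Sym²` by `Sym⁴` (at `p = 7`:
`L(4)`, `d = 5 < 7`, adequate by GHT Thm 1.3, `7` not a Fermat prime) resp. by the Steinberg module
`St₅ = L(4)` (at `p = 5`: `d = 5 = p`, projective, extended-adequate by GHT-II Cor 9.4); every even symmetric
power of an even `ρ` is orthogonal of odd rank with `tr Sym⁴ρ(c) · tr Sym⁴ρ_h(c) = +5 ≠ ±1`, contradicting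
Taylor's sign theorem once `Sym⁴ ρ_g ⊗ ρ_π` (rank 25) is shown potentially automorphic.  Why it might fail:
ordinary automorphic lifts of `Sym⁴ ρ̄` on `U(5)`, Geraghty connectivity on `GL₅/GL₂₅` and extended adequacy
(`5 ∣ dim St₅`) inside every lifting theorem used are printed only for `l ≥ 2(d+1)`.  Size L/XL.  Leans on:
GHT Thm 1.3 (arXiv:1311.1786), GHT-II Thm 1.7 / Cor 9.4 / 9.5 (arXiv:1405.0043; tree: `AdequacyDegreeP.lean`),
BLGGT Thm 4.2.1/4.5.1 (arXiv:1010.2561), Taylor sign theorem (doi:10.2140/ant.2012.6.405), `Tung2021_hilbertTotallySplit`.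
[cite: Calegari2011, §6 ("Some remarks on the condition p > 7")] -/
theorem stub_steinbergShadow :
    ∀ (p : ℕ) [Fact p.Prime], (p = 5 ∨ p = 7) →
      ∀ ρ : FramedGaloisRep ℚ (PadicAlgCl p) 2, ρ.IsEven →
        (∀ᶠ v : HeightOneSpectrum (𝓞 ℚ) in Filter.cofinite, ρ.IsUnramifiedAt v) →
        (∀ (v : HeightOneSpectrum (𝓞 ℚ)) (hv : ((p : ℕ) : 𝓞 ℚ) ∈ v.asIdeal),
          (fontainePstAdicCompletion v p hv).IsDeRhamFramed (ρ.toLocal v) ∧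
            ∀ τ : v.adicCompletion ℚ →+* PadicAlgCl p, Continuous τ →
              (ρ.labelledHodgeTateWeightsAt v (fontainePstAdicCompletion v p hv).algebra
                (fontainePstAdicCompletion v p hv).𝔅 τ).Nodup) →
        ρ.IsResiduallyAbsIrreducible → ¬ IsDihedralType ρ.residualRep →
        IsAbsIrreducible
          ((Matrix.GeneralLinearGroup.symSq.comp ρ.residualRep).comp
            (modPCyclotomicCharacterZMod ℚ p).ker.subtype) →
        ¬ Subgroup.IsThorneAdequate
          ((Matrix.GeneralLinearGroup.symSq.comp ρ.residualRep).comp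
            (modPCyclotomicCharacterZMod ℚ p).ker.subtype).range →
        False := by
  sorry

/-- **Stub B — failure of (2) forces `p = 7` and tetrahedral type (group theory; PROVABLE NOW, size M).**
For `p ∈ {5, 7}` and `ρ : Γ_ℚ → GL₂(ℚ̄_p)` residually absolutely irreducible with `ρ̄` not of dihedral type:
if `Sym² ρ̄|_{Γ_{ℚ(ζ_p)}}` is NOT absolutely irreducible then `p = 7` and `ρ̄` is of tetrahedral type
(projective image `≅ A₄`; then `ρ̄(Γ_{ℚ(ζ₇)})` is projectively the Klein four-group and the cubic resolvent
field is `ℚ(ζ₇)⁺`).  Proof sketch in the module docstring: `H = ρ̄(ker ε̄_p) ◁ G = ρ̄(Γ_ℚ)`, `G/H` cyclic of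
order dividing `p − 1`; `Sym² ≅ ad⁰ ⊗ det`; `ad⁰|_H` reducible ⟺ `PH` cyclic or dihedral (Clifford); the
normaliser of a torus resp. of `V₄` (`≅ S₄`) in `PGL₂(𝔽̄_p)` leaves only `PG ≅ A₄ ⊃ PH = V₄`, index `3 ∣ p − 1`.
No Dickson classification is needed.  Leans on: `ProjectiveType.lean` (`projectiveImage`, `IsDihedralType`,
`IsTetrahedralType`, `not_isIrreducible_of_isCyclicType`), `ResidualGaloisRep*.lean` (`residualRep_spec`,
Brauer–Nesbitt uniqueness, open kernel ⇒ finite image), Mathlib `DihedralGroup`, `alternatingGroup`.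
[folklore] -/
theorem stub_symSqReducible_tetrahedralSeven :
    ∀ (p : ℕ) [Fact p.Prime], (p = 5 ∨ p = 7) →
      ∀ ρ : FramedGaloisRep ℚ (PadicAlgCl p) 2,
        ρ.IsResiduallyAbsIrreducible → ¬ IsDihedralType ρ.residualRep →
        ¬ IsAbsIrreducible
          ((Matrix.GeneralLinearGroup.symSq.comp ρ.residualRep).comp
            (modPCyclotomicCharacterZMod ℚ p).ker.subtype) →
        p = 7 ∧ IsTetrahedralType ρ.residualRep := by
  sorry

/-- **Stub C — the tetrahedral Klein cell at `p = 7` (OPEN; the line's ceiling).**  There is no continuous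
even `ρ : Γ_ℚ → GL₂(ℚ̄₇)`, unramified almost everywhere, de Rham above `7` with multiplicity-free labelled
Hodge–Tate weights, residually absolutely irreducible and non-dihedral, with `ρ̄` of TETRAHEDRAL type and
`Sym² ρ̄|_{Γ_{ℚ(ζ₇)}}` NOT absolutely irreducible (i.e. `ρ̄(Γ_{ℚ(ζ₇)})` projectively `V₄`: the cubic resolvent
field of the `A₄`-extension is `ℚ(ζ₇)⁺`).  Why plausibly true: it is an instance of the Fontaine–Mazur
conjecture (clause (B) of the summit); why hard: every functorial shadow `Sym^{2m} ρ̄` is a sum of characters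
over `ℚ(ζ₇)`, so no adequate-image lifting theorem applies (Calegari's method has no purchase); the cell is
residually inhabited and automatically even (refuter's PARI job j022937: `x⁴ − 2x³ − 14x² + 2x + 27`, totally
real `A₄` field, resolvent `x³ − x² − 2x + 1`, discriminant `49`).  Over the totally real cubic field `ℚ(ζ₇)⁺`
the restriction of `ρ` is even, regular and residually dihedral (induced from the biquadratic CM/real layer) —
the residually-dihedral even case, listed by the route under NOT DECOMPOSED YET; candidate levers: dihedral/CM
congruence methods over `ℚ(ζ₇)⁺`, `ℓ`-adic-image patching à la Newton–Thorne (arXiv:1912.11265), a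
Khare–Thorne-type functorial detour.  Size: open problem (expected TRUE).
[cite: Calegari2011, Thm. 1.1 (the statement this instantiates at p = 7) and §6] -/
theorem stub_tetrahedralKleinCell :
    ∀ (p : ℕ) [Fact p.Prime], p = 7 →
      ∀ ρ : FramedGaloisRep ℚ (PadicAlgCl p) 2, ρ.IsEven →
        (∀ᶠ v : HeightOneSpectrum (𝓞 ℚ) in Filter.cofinite, ρ.IsUnramifiedAt v) →
        (∀ (v : HeightOneSpectrum (𝓞 ℚ)) (hv : ((p : ℕ) : 𝓞 ℚ) ∈ v.asIdeal),
          (fontainePstAdicCompletion v p hv).IsDeRhamFramed (ρ.toLocal v) ∧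
            ∀ τ : v.adicCompletion ℚ →+* PadicAlgCl p, Continuous τ →
              (ρ.labelledHodgeTateWeightsAt v (fontainePstAdicCompletion v p hv).algebra
                (fontainePstAdicCompletion v p hv).𝔅 τ).Nodup) →
        ρ.IsResiduallyAbsIrreducible → ¬ IsDihedralType ρ.residualRep →
        IsTetrahedralType ρ.residualRep →
        ¬ IsAbsIrreducible
          ((Matrix.GeneralLinearGroup.symSq.comp ρ.residualRep).comp
            (modPCyclotomicCharacterZMod ℚ p).ker.subtype) →
        False := by
  sorry

/-! ## 2. The stub statements as named `Prop`s (literally their types) -/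

namespace _Goal

/-- The statement of `stub_symSqAdequateShadow`, as a named `Prop` (literally its type). [folklore] -/
def stub_symSqAdequateShadow : Prop :=
  type_of% @Summit.Langlands.Langlands.Cruxes.FiveSevenSteinbergShadow.Birth.stub_symSqAdequateShadow

/-- The statement of `stub_steinbergShadow`, as a named `Prop` (literally its type). [folklore] -/
def stub_steinbergShadow : Prop :=
  type_of% @Summit.Langlands.Langlands.Cruxes.FiveSevenSteinbergShadow.Birth.stub_steinbergShadow

/-- The statement of `stub_symSqReducible_tetrahedralSeven`, as a named `Prop` (literally its type).
[folklore] -/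
def stub_symSqReducible_tetrahedralSeven : Prop :=
  type_of% @Summit.Langlands.Langlands.Cruxes.FiveSevenSteinbergShadow.Birth.stub_symSqReducible_tetrahedralSeven

/-- The statement of `stub_tetrahedralKleinCell`, as a named `Prop` (literally its type). [folklore] -/
def stub_tetrahedralKleinCell : Prop :=
  type_of% @Summit.Langlands.Langlands.Cruxes.FiveSevenSteinbergShadow.Birth.stub_tetrahedralKleinCell

end _Goal

/-! ## 3. Assembly (sorry-free) -/

/-- **ASSEMBLY (kernel-checked, no `sorry`).**  The four stub statements imply the crux
`Summit.Langlands.Langlands.Theses.EvenVoidBelowEight.FiveSevenSteinbergShadow` (concluded BY NAME): classical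
case split on Calegari's hypothesis (2) `IsAbsIrreducible (Sym² ρ̄|_{Γ_{ℚ(ζ_p)}})`; if it holds, split on
Thorne-adequacy of the shadow image (A1 / A2); if it fails, B gives `p = 7` and tetrahedral type, and C closes
the Klein cell.  Every stub is load-bearing. [folklore] -/
theorem FiveSevenSteinbergShadow_of (hA : _Goal.stub_symSqAdequateShadow) (hS : _Goal.stub_steinbergShadow)
    (hB : _Goal.stub_symSqReducible_tetrahedralSeven) (hC : _Goal.stub_tetrahedralKleinCell) :
    FiveSevenSteinbergShadow := by
  intro p _ h57 ρ hev hur hdR hirr hdih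
  classical
  by_cases h2 : IsAbsIrreducible
      ((Matrix.GeneralLinearGroup.symSq.comp ρ.residualRep).comp
        (modPCyclotomicCharacterZMod ℚ p).ker.subtype)
  · by_cases had : Subgroup.IsThorneAdequate
        ((Matrix.GeneralLinearGroup.symSq.comp ρ.residualRep).comp
          (modPCyclotomicCharacterZMod ℚ p).ker.subtype).range
    · exact hA p h57 ρ hev hur hdR hirr hdih h2 had
    · exact hS p h57 ρ hev hur hdR hirr hdih h2 had
  · obtain ⟨hp7, htet⟩ := hB p h57 ρ hirr hdih h2
    exact hC p hp7 ρ hev hur hdR hirr hdih htet h2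

/-- **The crux from the registered stubs** (kernel check that each `_Goal.stub_*` is literally the type of the
corresponding `stub_*`; the only `sorry`s in the closure are the four stubs'). [folklore] -/
theorem FiveSevenSteinbergShadow_of_stubs : FiveSevenSteinbergShadow :=
  FiveSevenSteinbergShadow_of stub_symSqAdequateShadow stub_steinbergShadow
    stub_symSqReducible_tetrahedralSeven stub_tetrahedralKleinCell

/-! ## 4. Certificates (sorry-free): the crux implies every `→ False` stub; the summit is not needed -/

/-- **Size certificate.** The crux implies stubs A1, A2 and C by one-liners (each is the crux with extra
hypotheses), so the cut LOCATES the content of the crux along hypothesis (2) and adequacy rather than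
shrinking it; stub B is independent group theory. [folklore] -/
theorem shadow_stubs_of_crux (h : FiveSevenSteinbergShadow) :
    _Goal.stub_symSqAdequateShadow ∧ _Goal.stub_steinbergShadow ∧ _Goal.stub_tetrahedralKleinCell :=
  ⟨fun p _ h57 ρ hev hur hdR hirr hdih _ _ => h p h57 ρ hev hur hdR hirr hdih,
    fun p _ h57 ρ hev hur hdR hirr hdih _ _ => h p h57 ρ hev hur hdR hirr hdih,
    fun p _ hp7 ρ hev hur hdR hirr hdih _ _ => h p (Or.inr hp7) ρ hev hur hdR hirr hdih⟩

end Summit.Langlands.Langlands.Cruxes.FiveSevenSteinbergShadow.Birth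

end
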